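/-
Origin: expansion seat `planner-pub-hodgecm-pv14-0`, handover v4 2026-08-18 (`HOME/pub-hodgecm-pv14/lean/Pv14/PerL34/P43Isotypic.lean`, md5 34a4afb0, 180 lines);
landed by the gen-6 packager in gate run 22 as `HodgeCM/PerL34/P43_isotypic.lean` (verbatim).
-/
/-
Origin: HOME/pub-hodgecm-pv14/lean/Pv14/PerL34/P43Isotypic.lean — session planner-pub-hodgecm-pv14-0 (unit pub-hodgecm-pv14,
node N33b holder).  Intended final place: `HodgeCM/PerL34/P43_isotypic.lean`, after `P43_forms.lean` (pv14, run 18).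
KERNEL (pure linear algebra): the binder `PtypeStableF` of N33b — "`ω(h_f)` preserves the `K_∞`-type `𝔭₊ ⊠ 𝟏`
subspace `S[𝔭₊ ⊠ 𝟏]`" — from the commuting of `ω(G_U(𝔸_f))` with `ω(K_∞)` (PRINT: `ω` is a representation of the
product group, tex l. 342 / §3.2), once `S[𝔭₊ ⊠ 𝟏]` is TYPED as what it is: an isotypic subspace.
-/
import Summits.HodgeConjecture.HodgeCM.PerL34.P43_forms

/-!
# The `K`-isotypic subspace and its stability under commuting operators

For `K`-actions `ρ` on `S` and `ρP` on a fixed `K`-module `P` (think `P = 𝔭₊ ⊠ 𝟏`, irreducible), the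
`P`-ISOTYPIC SUBSPACE of `S` is typed as the sum of the images of all `K`-equivariant linear maps `P → S`
(`isotypic ρ ρP := ⨆_f range f`; for `P` irreducible and `S` semisimple this is the usual isotypic component, and in
general it is the largest subspace generated by copies of quotients of `P`).  With this definition the standard fact
"an operator commuting with `K` preserves every isotypic subspace" is one line: `T ∘ f` is again a `K`-map.
Consequence for N33b: `ThetaKernelData.PtypeStableF` (tex l. 656–657, the membership half of N33b (ii)) holds as
soon as `Ptype = isotypic ρ ρP` for the `K_∞`-action `ρ = ω|_{K_∞}` and `ω(h_f)` commutes with `ρ` — KERNEL; the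
only PRINT input left is the commuting (l. 342).  Nothing cited, nothing asserted.
-/

set_option autoImplicit false

namespace HodgeCM
namespace PerL34
namespace P43Isotypic

section Isotypic

variable {Kc S P : Type*} [AddCommGroup S] [Module ℂ S] [AddCommGroup P] [Module ℂ P]
  (ρ : Kc → S →ₗ[ℂ] S) (ρP : Kc → P →ₗ[ℂ] P)

/-- `K`-equivariant linear maps `P → S`. -/
def IsKHom (f : P →ₗ[ℂ] S) : Prop := ∀ k, f ∘ₗ ρP k = ρ k ∘ₗ f

/-- The `P`-isotypic subspace of `S`: the sum of the images of all `K`-equivariant maps `P → S`. -/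
def isotypic : Submodule ℂ S := ⨆ f : {f : P →ₗ[ℂ] S // IsKHom ρ ρP f}, LinearMap.range f.1

/-- (Ported verbatim from the HodgeCMPerL package; no docstring in the source.) -/
theorem range_le_isotypic {f : P →ₗ[ℂ] S} (hf : IsKHom ρ ρP f) : LinearMap.range f ≤ isotypic ρ ρP :=
  le_iSup (fun f : {f : P →ₗ[ℂ] S // IsKHom ρ ρP f} => LinearMap.range f.1) ⟨f, hf⟩

/-- (Ported verbatim from the HodgeCMPerL package; no docstring in the source.) -/
theorem isKHom_comp {f : P →ₗ[ℂ] S} (hf : IsKHom ρ ρP f) (T : S →ₗ[ℂ] S)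
    (hT : ∀ k, T ∘ₗ ρ k = ρ k ∘ₗ T) : IsKHom ρ ρP (T ∘ₗ f) := by
  intro k
  rw [LinearMap.comp_assoc, hf k, ← LinearMap.comp_assoc, hT k, LinearMap.comp_assoc]

/-- **An operator commuting with `K` preserves the isotypic subspace.** -/
theorem map_isotypic_le (T : S →ₗ[ℂ] S) (hT : ∀ k, T ∘ₗ ρ k = ρ k ∘ₗ T) :
    (isotypic ρ ρP).map T ≤ isotypic ρ ρP := by
  unfold isotypic
  rw [Submodule.map_iSup]
  refine iSup_le fun f => ?_
  rw [← LinearMap.range_comp]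
  exact range_le_isotypic ρ ρP (isKHom_comp ρ ρP f.2 T hT)

/-- (Ported verbatim from the HodgeCMPerL package; no docstring in the source.) -/
theorem mem_isotypic_of_commute (T : S →ₗ[ℂ] S) (hT : ∀ k, T ∘ₗ ρ k = ρ k ∘ₗ T) {φ : S}
    (hφ : φ ∈ isotypic ρ ρP) : T φ ∈ isotypic ρ ρP :=
  map_isotypic_le ρ ρP T hT ⟨φ, hφ, rfl⟩

/-- Conversely every `K`-stable subspace that is a sum of copies of (quotients of) `P` is contained in
`isotypic ρ ρP` — in particular the images of `K`-maps from `P` (sanity: the definition is not too small). -/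
theorem mem_isotypic_of_range {f : P →ₗ[ℂ] S} (hf : IsKHom ρ ρP f) (p : P) : f p ∈ isotypic ρ ρP :=
  range_le_isotypic ρ ρP hf ⟨p, rfl⟩

end Isotypic

section N33b

variable {Ginf Gc Gf V S : Type*} [AddCommGroup V] [Module ℂ V] [AddCommGroup S] [Module ℂ S]
  (M : P43Forms.ThetaKernelData Ginf Gc Gf V S)

/-- **`PtypeStableF` KERNEL** (tex l. 656–657 with l. 342): if `S[𝔭₊ ⊠ 𝟏]` is the `P`-isotypic subspace for the
`K_∞`-action `ρ` and every `ω(h_f)` commutes with `ρ(K_∞)`, then `ω(h_f) S[𝔭₊ ⊠ 𝟏] ⊆ S[𝔭₊ ⊠ 𝟏]`. -/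
theorem ptypeStableF_of_isotypic {Kc P : Type*} [AddCommGroup P] [Module ℂ P]
    (ρ : Kc → S →ₗ[ℂ] S) (ρP : Kc → P →ₗ[ℂ] P) (hP : M.Ptype = isotypic ρ ρP)
    (hcomm : ∀ h k, M.ωf h ∘ₗ ρ k = ρ k ∘ₗ M.ωf h) : M.PtypeStableF := by
  intro h φ hφ
  rw [hP] at hφ ⊢
  exact mem_isotypic_of_commute ρ ρP (M.ωf h) (hcomm h) hφ

/-- The same for the compact real factors: `ω(c)` commuting with `ρ(K_∞)` preserves `S[𝔭₊ ⊠ 𝟏]` (the weaker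
STABILITY; `PtypeFixedC` — `ω(c)` FIXES the type-`𝟏` vectors — is the definition of "type `𝟏` at `b ≠ ι₁`"). -/
theorem ptypeStableC_of_isotypic {Kc P : Type*} [AddCommGroup P] [Module ℂ P]
    (ρ : Kc → S →ₗ[ℂ] S) (ρP : Kc → P →ₗ[ℂ] P) (hP : M.Ptype = isotypic ρ ρP)
    (hcomm : ∀ c k, M.ωc c ∘ₗ ρ k = ρ k ∘ₗ M.ωc c) : ∀ c, ∀ φ ∈ M.Ptype, M.ωc c φ ∈ M.Ptype := by
  intro c φ hφ
  rw [hP] at hφ ⊢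
  exact mem_isotypic_of_commute ρ ρP (M.ωc c) (hcomm c) hφ

/-- The subspace of vectors FIXED by a family of operators (type `𝟏` at the definite places `b ≠ ι₁`: `K_b` is the
whole local group `U(V_{3,b})(ℝ) ≅ U(3)`, tex l. 239 / l. 654). -/
def fixedSub {G : Type*} (ω : G → S →ₗ[ℂ] S) : Submodule ℂ S where
  carrier := {φ | ∀ c, ω c φ = φ}
  add_mem' := by
    intro a b ha hb c
    rw [map_add, ha c, hb c]
  zero_mem' := by
    intro c
    exact map_zero _
  smul_mem' := by
    intro r a ha c
    rw [map_smul, ha c]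

/-- (Ported verbatim from the HodgeCMPerL package; no docstring in the source.) -/
theorem mem_fixedSub {G : Type*} (ω : G → S →ₗ[ℂ] S) (φ : S) : φ ∈ fixedSub ω ↔ ∀ c, ω c φ = φ := Iff.rfl

/-- **Both `K`-type binders of N33b KERNEL from the full typing of `S[𝔭₊ ⊠ 𝟏]`**: if
`S[𝔭₊ ⊠ 𝟏] = (𝔭₊-isotypic for K_{ι₁}) ⊓ (vectors fixed by the compact factors G_c)` and `ω(h_f)` commutes with
`ω(K_{ι₁})` and with `ω(G_c)` (PRINT l. 342: `ω` is a representation of the product group, whose factors commute),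
then `PtypeStableF` (ω(h_f)-stability) and `PtypeFixedC` (fixed by `ω(G_c)`) hold. -/
theorem ptype_binders_of_typing {Kc P : Type*} [AddCommGroup P] [Module ℂ P]
    (ρ : Kc → S →ₗ[ℂ] S) (ρP : Kc → P →ₗ[ℂ] P) (hP : M.Ptype = isotypic ρ ρP ⊓ fixedSub M.ωc)
    (hcommK : ∀ h k, M.ωf h ∘ₗ ρ k = ρ k ∘ₗ M.ωf h) (hcommC : ∀ h c, M.ωf h ∘ₗ M.ωc c = M.ωc c ∘ₗ M.ωf h) :
    M.PtypeStableF ∧ M.PtypeFixedC := by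
  refine ⟨fun h φ hφ => ?_, fun c φ hφ => ?_⟩
  · rw [hP] at hφ ⊢
    refine ⟨mem_isotypic_of_commute ρ ρP (M.ωf h) (hcommK h) hφ.1, fun c => ?_⟩
    have := LinearMap.congr_fun (hcommC h c) φ
    simp only [LinearMap.coe_comp, Function.comp_apply] at this
    rw [← this, hφ.2 c]
  · rw [hP] at hφ
    exact hφ.2 c

/-- **`ThetaEquivariantF` KERNEL from the construction of `θ`** (tex l. 264–266: `θ_φ(x) = Σ_ξ (ω(x)φ)(ξ)`
integrated against `χ'_i` over the compact `[U(W_i)]` and packaged along `𝔭₊` — all of which is ONE linear map `Θ`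
applied to `ω(x)φ`): if `theta φ (g, c, h) = Θ (ω_∞(g) (ω(c) (ω(h) φ)))` and `h ↦ ω(h)` is multiplicative, then
`θ(ω(h)φ) = R(h) θ(φ)`. -/
theorem thetaEquivariantF_of_weil [Group Gf] (ωinf : Ginf → S →ₗ[ℂ] S) (Θ : S →ₗ[ℂ] V)
    (hθ : ∀ φ x, M.theta φ x = Θ (ωinf x.1 (M.ωc x.2.1 (M.ωf x.2.2 φ))))
    (hmul : ∀ h h' : Gf, M.ωf (h' * h) = M.ωf h' ∘ₗ M.ωf h) : M.ThetaEquivariantF := by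
  intro h φ
  funext x
  show M.theta (M.ωf h φ) x = M.theta φ (x.1, x.2.1, x.2.2 * h)
  rw [hθ, hθ, hmul, LinearMap.coe_comp, Function.comp_apply]

/-- **`ThetaEquivariantC` KERNEL** likewise, using that `ω(h_f)` commutes with `ω(c)` (PRINT l. 342) and that
`c ↦ ω(c)` is multiplicative. -/
theorem thetaEquivariantC_of_weil [Group Gc] (ωinf : Ginf → S →ₗ[ℂ] S) (Θ : S →ₗ[ℂ] V)
    (hθ : ∀ φ x, M.theta φ x = Θ (ωinf x.1 (M.ωc x.2.1 (M.ωf x.2.2 φ))))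
    (hmul : ∀ c c' : Gc, M.ωc (c' * c) = M.ωc c' ∘ₗ M.ωc c)
    (hcomm : ∀ (h : Gf) (c : Gc), M.ωf h ∘ₗ M.ωc c = M.ωc c ∘ₗ M.ωf h) : M.ThetaEquivariantC := by
  intro c φ
  funext x
  show M.theta (M.ωc c φ) x = M.theta φ (x.1, x.2.1 * c, x.2.2)
  have hx : M.ωf x.2.2 (M.ωc c φ) = M.ωc c (M.ωf x.2.2 φ) := by
    simpa only [LinearMap.coe_comp, Function.comp_apply] using LinearMap.congr_fun (hcomm x.2.2 c) φ
  rw [hθ, hθ, hx, hmul, LinearMap.coe_comp, Function.comp_apply]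

/-- **`LeftInvariant` from the automorphy of the theta DISTRIBUTION** (INPUT N10 / PRINT Weil 1964, in its
invariant form): with `θ` typed as above through ONE linear map `Θ` and the three factor representations
multiplicative and pairwise commuting, if `Θ ∘ ω(γ) = Θ` for `γ` in (the image of) `G_U(L₀)` then every theta
function — in particular every `F ∈ Θ_i(χ'_i)[𝔭₊]` — is left-`Γ`-invariant.  (So the binder `hL` of N33b is
N10 applied BY NAME to the distribution, plus kernel bookkeeping.) -/
theorem leftInvariant_of_weil [Group Ginf] [Group Gc] [Group Gf] (ωinf : Ginf → S →ₗ[ℂ] S) (Θ : S →ₗ[ℂ] V)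
    (hθ : ∀ φ x, M.theta φ x = Θ (ωinf x.1 (M.ωc x.2.1 (M.ωf x.2.2 φ))))
    (hmulI : ∀ g g' : Ginf, ωinf (g' * g) = ωinf g' ∘ₗ ωinf g)
    (hmulC : ∀ c c' : Gc, M.ωc (c' * c) = M.ωc c' ∘ₗ M.ωc c)
    (hmulF : ∀ h h' : Gf, M.ωf (h' * h) = M.ωf h' ∘ₗ M.ωf h)
    (hcommIC : ∀ (g : Ginf) (c : Gc), ωinf g ∘ₗ M.ωc c = M.ωc c ∘ₗ ωinf g)
    (hcommIF : ∀ (g : Ginf) (h : Gf), ωinf g ∘ₗ M.ωf h = M.ωf h ∘ₗ ωinf g)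
    (hcommCF : ∀ (c : Gc) (h : Gf), M.ωc c ∘ₗ M.ωf h = M.ωf h ∘ₗ M.ωc c)
    (Γ : Subgroup (Ginf × Gc × Gf))
    (hΘ : ∀ γ ∈ Γ, Θ ∘ₗ (ωinf γ.1 ∘ₗ M.ωc γ.2.1 ∘ₗ M.ωf γ.2.2) = Θ) : M.LeftInvariant Γ := by
  intro F hF γ hγ x
  obtain ⟨φ, -, rfl⟩ := hF
  have hIC := fun g c v => LinearMap.congr_fun (hcommIC g c) v
  have hIF := fun g h v => LinearMap.congr_fun (hcommIF g h) v
  have hCF := fun c h v => LinearMap.congr_fun (hcommCF c h) v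
  simp only [LinearMap.coe_comp, Function.comp_apply] at hIC hIF hCF
  have key := LinearMap.congr_fun (hΘ γ hγ) (ωinf x.1 (M.ωc x.2.1 (M.ωf x.2.2 φ)))
  simp only [LinearMap.coe_comp, Function.comp_apply] at key
  rw [hθ, hθ, Prod.fst_mul, Prod.snd_mul, Prod.fst_mul, Prod.snd_mul, hmulI, hmulC, hmulF]
  simp only [LinearMap.coe_comp, Function.comp_apply]
  rw [← key, hIC x.1 γ.2.1, hCF x.2.1 γ.2.2, hIF x.1 γ.2.2]

end N33b

end P43Isotypic
end PerL34
end HodgeCM
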